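import Literature.AlgebraicGeometry.HodgeTheory.SpreadingOutQbarFamilyProofs
import HarnessLib

/-!
# Spreading out a smooth projective variety over `K = Frac A` to a smooth projective family over a
# basic open `D(t) ⊆ Spec A` of a PRESCRIBED normal Noetherian base (EGA IV₃ §8, IV₄ 17.7.8; Stacks 0AY8)

Topic `Literature/AlgebraicGeometry/Limits`. Theorems only (no definition, no named fact). Written by the
prover seat `hodge-nonav-prover-Bx` (g18, cell `hodge-nonav`) as brick **QF-2 «MODEL»** of the programme
«Q-FAMILY» (memo `PROGRAMME-Q-FAMILY-Bx-g18.md`, `--supports stmt-HodgeConjecture-24190`), but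
route-agnostic.

The tree's `HodgeTheory.SpreadingOutQbar.exists_smooth_projective_spread` spreads a smooth projective
geometrically irreducible `K`-variety `E` to a smooth projective family with geometrically irreducible
fibres over `Spec T`, `T ⊆ K` a finitely generated `k`-algebra CHOSEN BY THE PROOF. When `K = Frac A` is
already the fraction field of a given integrally closed Noetherian domain `A` (in «Q-FAMILY»: the
polynomial ring of the parameter space, whose basic opens are the Zariski-opens the consumer needs), the
same argument — from its step D on, with `R := A` and `K₀ := K` — gives the family over a BASIC OPEN
`D(t) = Spec A[1/t]` of the prescribed base:

* `exists_smooth_projective_spread_away` — for `E` smooth projective geometrically irreducible of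
  dimension `n` over `K = Frac A`, `A` an integrally closed Noetherian domain with `char K = 0` not
  needed (no perfectness is used: `E` is already smooth), there are `t ≠ 0` in `A`, a closed subscheme
  `Y ↪ ℙᴺ_{A[1/t]}` whose structure morphism `g : Y → Spec A[1/t]` is proper, smooth of relative
  dimension `n` and has geometrically irreducible fibres, and a cartesian square exhibiting
  `E → Spec K` as the base change of `g` along `Spec K → Spec A[1/t]`.

Proof (verbatim the steps D–E3 of `exists_smooth_projective_spread`): irreducible projective model over
`A` (`exists_irreducible_projectiveModel A K E`, Stacks 081I); smoothness of the model over some `D(s)`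
(`Limits.LocApprox.exists_forall_smooth_snd`, EGA IV₄ 17.7.8 / Stacks 0C0C); closed immersion of the
localized model into `ℙᴺ_{A[1/t]}` (`exists_isClosedImmersion_pullback_proj`); the relative dimension is
constant on the irreducible total space and equals `n` (compare on `E`); `A[1/t]` is integrally closed, so
all fibres are geometrically irreducible (`geometricallyIrreducible_of_genericFibre`, Stacks 0AY8 + 056T).

## References

* [EGAIV3] A. Grothendieck, J. Dieudonné, EGA IV₃ (1966), Thm. 8.8.2, Thm. 8.10.5.
* [EGAIV4] EGA IV₄ (1967), Prop. 17.7.8.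
* [StacksProject] The Stacks Project, Tags 081I, 0C0C, 0AY8, 056T.
-/

noncomputable section

set_option backward.isDefEq.respectTransparency false

universe u

open CategoryTheory CategoryTheory.Limits AlgebraicGeometry TopologicalSpace MvPolynomial
open Literature.AlgebraicGeometry.Morphisms Literature.AlgebraicGeometry.Motives
open Literature.AlgebraicGeometry.HodgeTheory.SpreadingOutQbar

namespace Literature.AlgebraicGeometry.Limits

attribute [local instance] MvPolynomial.gradedAlgebra

/-- **Spreading out a smooth projective variety over `Frac A` to a smooth projective family over a
basic open of the prescribed normal base `Spec A`** (EGA IV₃ 8.10.5, IV₄ 17.7.8; Stacks 0AY8): for `A`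
an integrally closed Noetherian domain with fraction field `K` and `E` a smooth projective geometrically
irreducible `K`-variety of dimension `n`, there are `t ≠ 0`, a model `T` of `A[1/t]` between `A` and `K` (`Frac T = K`), `N`, a closed
subscheme `emb : Y ↪ ℙᴺ_T` with structure morphism `g = emb ≫ (ℙᴺ → Spec A[1/t])` proper, smooth of relative dimension `n` and
geometrically irreducible (all fibres), and `π : E → Y` cartesian over `Spec K → Spec A[1/t]`.
[cite: EGAIV3, Thm. 8.10.5] [cite: EGAIV4, Prop. 17.7.8] [cite: StacksProject, Tag 0AY8] -/
theorem exists_smooth_projective_spread_away {A K : Type u} [CommRing A] [IsDomain A]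
    [IsNoetherianRing A] [IsIntegrallyClosed A] [Field K] [Algebra A K] [IsFractionRing A K]
    {n : ℕ} {E : SchemeOver K} (hE : IsSmoothProjective n E) :
    ∃ (t : A) (_ : t ≠ 0) (T : Type u) (_ : CommRing T) (_ : IsDomain T) (_ : Algebra A T)
      (_ : IsLocalization.Away t T) (_ : Algebra T K) (_ : IsScalarTower A T K) (_ : IsFractionRing T K)
      (N : ℕ) (Y : Scheme.{u}) (g : Y ⟶ Spec (.of T))
      (emb : Y ⟶ Proj (homogeneousSubmodule (Fin (N + 1)) T)) (_ : IsClosedImmersion emb)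
      (π : E.left ⟶ Y),
      emb ≫ ProjBaseChangeRing.projToSpec (Fin (N + 1)) T = g ∧
      IsProper g ∧ SmoothOfRelativeDimension n g ∧ GeometricallyIrreducible g ∧
      IsPullback π E.hom g (Spec.map (CommRingCat.ofHom (algebraMap T K))) := by
  classical
  -- A. `E` is integral
  haveI := hE.smoothOfRelativeDimension
  haveI : Smooth E.hom := SmoothOfRelativeDimension.smooth n E.hom
  haveI : IsReduced E.left := isReduced_of_smoothOfRelativeDimension E.hom n
  haveI : GeometricallyIrreducible E.hom := hE.geometricallyIrreducible
  haveI : Subsingleton ↥(Spec (CommRingCat.of K)) :=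
    inferInstanceAs (Subsingleton (PrimeSpectrum K))
  haveI : IrreducibleSpace E.left :=
    GeometricallyIrreducible.irreducibleSpace_of_subsingleton (f := E.hom)
  haveI : IsIntegral E.left := isIntegral_of_irreducibleSpace_of_isReduced E.left
  haveI : GeometricallyReduced E.hom := geometricallyReduced_of_smooth E.hom
  haveI : GeometricallyIntegral E.hom :=
    GeometricallyIntegral.of_geometricallyReduced_of_geometricallyIrreducible _
  -- D. an irreducible projective model over `A`
  haveI : IsNoetherianRing (CommRingCat.of A) := ‹IsNoetherianRing A›
  haveI : IsLocallyNoetherian (Spec (CommRingCat.of A)) :=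
    (isLocallyNoetherian_Spec (R := CommRingCat.of A)).mpr ‹_›
  obtain ⟨N', P, emb, hemb, gen, hPirr, HM⟩ := exists_irreducible_projectiveModel A K E hE.isProjectiveOver
  haveI : IsProper (ProjBaseChangeRing.projToSpec (Fin (N' + 1)) A) :=
    ProjBaseChangeRing.isProper_projToSpec _ A
  obtain ⟨f, hf⟩ : ∃ f : P ⟶ Spec (.of A), f = emb ≫ ProjBaseChangeRing.projToSpec (Fin (N' + 1)) A :=
    ⟨_, rfl⟩
  rw [← hf] at HM
  haveI : IsProper f := by rw [hf]; infer_instance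
  haveI : LocallyOfFiniteType f := ‹IsProper f›.toLocallyOfFiniteType
  haveI : QuasiCompact f := inferInstance
  set jK : Spec (.of K) ⟶ Spec (.of A) := Spec.map (CommRingCat.ofHom (algebraMap A K)) with hjK
  -- E1. the model is smooth over a dense open
  have hgenSm : Smooth (pullback.snd f jK) := by
    rw [← HM.isoPullback_inv_snd]; infer_instance
  haveI : LocallyOfFinitePresentation (Over.mk f : SchemeOver A).hom :=
    LocallyOfFinitePresentation.iff_locallyOfFiniteType.mpr ‹LocallyOfFiniteType f›
  haveI : QuasiCompact (Over.mk f : SchemeOver A).hom := ‹QuasiCompact f›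
  obtain ⟨t, ht, H₁⟩ := Limits.LocApprox.exists_forall_smooth_snd (nonZeroDivisors A) K (Over.mk f) hgenSm
  have ht0 : t ≠ 0 := nonZeroDivisors.ne_zero ht
  -- the localisation `T = A[1/t]` and the maps `A → T → K`
  let T : Type u := Localization.Away t
  haveI : IsDomain T := IsLocalization.isDomain_localization (M := Submonoid.powers t)
    (powers_le_nonZeroDivisors_of_noZeroDivisors ht0)
  haveI : IsNoetherianRing T := IsLocalization.isNoetherianRing (Submonoid.powers t) T inferInstance
  have hunit : IsUnit (algebraMap A K t) :=
    Ne.isUnit ((IsFractionRing.to_map_eq_zero_iff (K := K)).not.mpr ht0)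
  let φ₀ : T →+* K := IsLocalization.Away.lift t hunit
  letI : Algebra T K := φ₀.toAlgebra
  haveI : IsScalarTower A T K :=
    IsScalarTower.of_algebraMap_eq fun r ↦ (IsLocalization.Away.lift_eq t hunit r).symm
  haveI : IsFractionRing T K :=
    IsFractionRing.isFractionRing_of_isDomain_of_isLocalization (Submonoid.powers t) T _
  -- the family `g : Y = P ×_A Spec T → Spec T`
  set jT : Spec (.of T) ⟶ Spec (.of A) := Spec.map (CommRingCat.ofHom (algebraMap A T)) with hjT
  haveI : IsOpenImmersion jT := IsOpenImmersion.of_isLocalization t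
  set jKT : Spec (.of K) ⟶ Spec (.of T) := Spec.map (CommRingCat.ofHom (algebraMap T K)) with hjKT
  have hjfac : jK = jKT ≫ jT := by
    rw [hjK, hjKT, hjT, ← Spec.map_comp, ← CommRingCat.ofHom_comp, ← IsScalarTower.algebraMap_eq]
  have sqY : IsPullback (pullback.fst f jT) (pullback.snd f jT) f jT := IsPullback.of_hasPullback f jT
  have hgSm : Smooth (pullback.snd f jT) := H₁ t (dvd_refl t) T
  obtain ⟨embT, hembT, hembTg⟩ : ∃ embT : pullback f jT ⟶ Proj (homogeneousSubmodule (Fin (N' + 1)) T),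
      IsClosedImmersion embT ∧ embT ≫ ProjBaseChangeRing.projToSpec (Fin (N' + 1)) T = pullback.snd f jT := by
    have h := exists_isClosedImmersion_pullback_proj T emb
    rw [← hf] at h
    exact h
  -- `E = Y ×_T Spec K`
  have HM' : IsPullback gen E.hom f (jKT ≫ jT) := hjfac ▸ HM
  let ℓE : E.left ⟶ pullback f jT :=
    sqY.lift gen (E.hom ≫ jKT) (by rw [Category.assoc]; exact HM'.w)
  have hℓ₁ : ℓE ≫ pullback.fst f jT = gen := sqY.lift_fst _ _ _
  have hℓ₂ : ℓE ≫ pullback.snd f jT = E.hom ≫ jKT := sqY.lift_snd _ _ _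
  have SqE : IsPullback ℓE E.hom (pullback.snd f jT) jKT :=
    IsPullback.of_right (by rw [hℓ₁]; exact HM') hℓ₂ sqY
  -- `Y` is irreducible, hence smooth of one relative dimension, which is `n` (compare on `E`)
  haveI : Nonempty ↥(pullback f jT) := ⟨ℓE.base (Classical.arbitrary E.left)⟩
  haveI : IrreducibleSpace ↥(pullback f jT) := (pullback.fst f jT).isOpenEmbedding.irreducibleSpace
  haveI : Smooth (pullback.snd f jT) := hgSm
  obtain ⟨d, hd⟩ := exists_smoothOfRelativeDimension_of_smooth (pullback.snd f jT)
  haveI := smoothOfRelativeDimension_isStableUnderBaseChange (n := d)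
  have hdE : SmoothOfRelativeDimension d E.hom := MorphismProperty.of_isPullback SqE hd
  obtain rfl : n = d :=
    (AbelianVarietyProofs.eq_of_smoothOfRelativeDimension E.hom hdE hE.smoothOfRelativeDimension).symm
  -- E3. all fibres are geometrically irreducible (Stacks 0AY8): `T` is integrally closed
  haveI : IsIntegrallyClosed T := isIntegrallyClosed_of_isLocalization T (Submonoid.powers t)
    (powers_le_nonZeroDivisors_of_noZeroDivisors ht0)
  haveI : GeometricallyIntegral
      ((pullback.snd f jT).fiberToSpecResidueField (genericPoint (Spec (.of T)))) :=
    of_isPullback_genericFibre (R := T) (K := K) @GeometricallyIntegral (pullback.snd f jT) SqE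
      inferInstance
  haveI : IsProper (pullback.snd f jT) := inferInstance
  haveI := hd
  have hgi : GeometricallyIrreducible (pullback.snd f jT) :=
    geometricallyIrreducible_of_genericFibre (pullback.snd f jT) n
  exact ⟨t, ht0, T, inferInstance, inferInstance, inferInstance, inferInstance, inferInstance, inferInstance,
    inferInstance, N', pullback f jT, pullback.snd f jT, embT, hembT, ℓE, hembTg, inferInstance, hd, hgi, SqE⟩

end Literature.AlgebraicGeometry.Limits

end
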